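import Literature.Topology.FourManifolds.HomotopySpheresBPOrderSignatureLeaves
import Literature.Topology.FourManifolds.DiscAttachmentClosedModel
import HarnessLib

/-!
# `224 ∣ σ(M₀)` for `bM₀ = S⁷`: the vendored leaf from the closed-manifold theorem

Topic `Literature/Topology/FourManifolds`; pure-proof companion of the named fact
`Literature.Topology.FourManifolds.HomotopySphere.twoHundredTwentyFour_dvd_of_mem_signatureSet_sphere`
(`HomotopySpheresBPOrderSignatureLeaves.lean`), the divisibility half of Kervaire–Milnor's
`σ₂ = 224`: M. Kervaire, J. Milnor, *Groups of homotopy spheres: I*, Ann. of Math. (2) 77 (1963),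
p. 529, "Now consider the collection of all `4m`-manifolds `M₀` which are s-parallelizable, and are
bounded by the `(4m-1)`-sphere. Clearly the corresponding signatures `σ(M₀) ∈ Z` form a group under
addition. Let `σₘ > 0` denote the generator of this group", and p. 530, "The following equality is
proved in [18, p. 457]: `σₘ = 2²ᵐ⁻¹(2²ᵐ⁻¹ - 1) Bₘ jₘ aₘ / m`" (`m = 2`: `B₂ = 1/30`, `a₂ = 1`,
`j₂ = 240`, `σ₂ = 8 · 7 · 240 / 60 = 224`). Reference [18] is Milnor–Kervaire, *Bernoulli numbers,
homotopy groups, and a theorem of Rohlin*, Proc. ICM 1958, whose Corollary (p. 457) reads "the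
index of any almost parallelizable `4n`-manifold is a multiple of `2²ⁿ⁻¹(2²ⁿ⁻¹ - 1) Bₙ jₙ aₙ / n`",
with "Since `π_{m+7}(Sᵐ)` is cyclic of order `240`, it follows that `j₂ = 240`" (ibid.); the printed
proof in book form is Kosinski, *Differential Manifolds* (1993), IX.8.7 ("The signatures of
`4k`-dimensional almost parallelizable closed manifolds form a group `tₖℤ`", first half of the
proof: `h_E(G) ∈ Ker J₄ₖ₋₁` (IX.6.3.4), `γ` a multiple of `j₄ₖ₋₁ η₄ₖ`, Bott's integrality (8.3),
`pₖ(ν)[M] = ± pₖ(TM)[M]` [MS 15.3] and the signature theorem), `t₂ = 224` (Ch. X §6, p. 217: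
"`t₂/8 = 28`").

That theorem is about **closed** manifolds; Kervaire–Milnor's `σ(M₀)` for `M₀` bounded by the
sphere is the signature of `M₀ ∪ cone(bM₀)` (footnote pp. 528–529), equivalently of the closed
smooth manifold `M = M₀ ∪_{S⁷} D⁸` ("Attaching a disc to the boundary of `M₁` produces a closed
manifold `M`", Kosinski, proof of IX.8.7; inversely Kervaire–Milnor, proof of Lemma 7.4, p. 529:
"Removing the interior of an imbedded `4m`-disk from this manifold, we obtain the required
parallelizable manifold `M₀`"). This file PROVES that passage for the tree's objects:

* `HomotopySphere.twoHundredTwentyFour_dvd_of_mem_signatureSet_sphere_of_closed` — **the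
  closed-manifold theorem implies the vendored leaf**: if `224 ∣ σ(X, μ)` for every closed smooth
  `8`-manifold `X` obtained by attaching `D⁸` along `S⁷` to an s-parallelizable compact `M₀` with
  `bM₀ = S⁷` (hypothesis `H`, stated inline) and every orientation `μ` of `X`, then
  `224 ∣ σ` for every `σ ∈ signatureSet g 2 h (𝕊⁷, o)` and all `g`, `o`. Proof: membership
  unfolds to an s-parallelizable null-cobordism `M₀ = c.W` of `𝕊⁷` and an orientation `μ'` of
  `M₀ ∪ cone(bM₀)` with `σ = σ(M₀, μ')`; the gluing `X = M₀ ∪_{id} D⁸` exists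
  (`exists_isBoundaryGluing_holds`), `M₀ ∪ cone(bM₀) ≃ₜ X` (`DiscAttachmentClosedModel.lean`: the
  disc of `X` is a chart ball, collapse it to its centre) and the signature is a homeomorphism
  invariant, so `σ = σ(X, μ)` for the transported orientation
  (`NullCobordism.exists_closed_signatureInDim_eq`).

About the hypothesis `H`. It is the statement a theory of Pontryagin numbers would prove, and it
is NOT proved here: neither the signature theorem `45 σ = 7 p₂ - p₁²`, nor Bott periodicity /
integrality (`π₇(SO) ≅ ℤ`, `p₂ = ± 6 γ`), nor `|im J₇| = 240` is in Mathlib or in the tree. Its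
class of manifolds — closed smooth `X = M₀ ∪_{S⁷} D⁸` with `M₀` s-parallelizable — is, for `M₀`
connected, exactly the class of almost parallelizable closed `8`-manifolds of Milnor–Kervaire and
Kosinski (Kosinski IX §8, p. 189: "let `M'` be `M` with a disc removed … If `M'` is
parallelizable", Def. (8.1) and the remark following it; Kervaire–Milnor Lemma 3.4, p. 509: "A
connected manifold with non-vacuous boundary is s-parallelizable if and only if it is
parallelizable"), so that for connected `M₀`
the hypothesis is literally the Corollary of [18] / the first half of IX.8.7 at `k = 2`. Kervaire–
Milnor's collection (p. 529) does not require `M₀` to be connected, and neither does the vendored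
fact; for disconnected `M₀` the closed components are closed s-parallelizable `8`-manifolds, whose
signature vanishes by the same signature-theorem computation (all their Pontryagin classes vanish;
Kosinski IX.8.5), and `σ` is additive over components — `H` asks for the conclusion `224 ∣ σ(X)`
in this generality, as Kervaire–Milnor state it. No definition and no named fact is introduced
(D-0026, net debt `0`).

## References

* M. A. Kervaire, J. W. Milnor, *Groups of homotopy spheres: I*, Ann. of Math. (2) 77 (1963),
  504–537: §7, p. 529 (the manifolds `M₀`, `σₘ`; proof of Lemma 7.4), p. 530 (formula for `σₘ`),
  footnote pp. 528–529, Lemma 3.4 (p. 509). doi:10.2307/1970128 [KervaireMilnorAnnals1963]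
* J. Milnor, M. Kervaire, *Bernoulli numbers, homotopy groups, and a theorem of Rohlin*, Proc.
  ICM Edinburgh 1958, CUP 1960, 454–458: Theorem 1, Corollary and `j₂ = 240` (p. 457).
  [MilnorKervaireICM1958]
* A. Kosinski, *Differential Manifolds*, Academic Press (1993), IX §8: (8.1), (8.3), 8.5, 8.7 and
  its proof (pp. 189–191); Ch. X §6, p. 217 (`t₂/8 = 28`). [Kosinski1993]
-/

open scoped Manifold ContDiff Topology
open Set Function

noncomputable section

namespace Literature.Topology.FourManifolds

open Literature.AlgebraicTopology.SingularHomology (HomologicalOrientation)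

namespace HomotopySphere

/-- **The closed-manifold theorem gives the leaf `224 ∣ σ(M₀)`.** Hypothesis `H` (not proved in
the tree): for every compact smooth `M₀ = c.W` with `bM₀ = 𝕊⁷` (a null-cobordism `c` of the
standard sphere) which is s-parallelizable, every closed smooth `8`-manifold `X` which is the
gluing `M₀ ∪_{id} 𝔻⁸` (`IsBoundaryGluing c.boundaryData (closedBallBoundaryData 7) id (𝓡 8) X`:
"attaching a disc to the boundary", Kosinski 1993, proof of IX.8.7) and every homological
orientation `μ` of `X`, the signature `σ(X, μ)` is a multiple of `224` — Milnor–Kervaire 1958,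
Corollary p. 457 ("the index of any almost parallelizable `4n`-manifold is a multiple of
`2²ⁿ⁻¹(2²ⁿ⁻¹ - 1) Bₙ jₙ aₙ / n`", `n = 2`, `j₂ = 240`: `224`) = Kosinski IX.8.7, first half of the
proof, `t₂ = 224` (p. 217), for the almost parallelizable closed `8`-manifolds `X = M₀ ∪ D⁸`
(Kosinski IX §8 (8.1) and p. 189; for disconnected `M₀` together with `σ = 0` for the closed
s-parallelizable components, IX.8.5, as in Kervaire–Milnor's formulation p. 529, which does not
assume `M₀` connected). Conclusion: the named fact
`twoHundredTwentyFour_dvd_of_mem_signatureSet_sphere` (Kervaire–Milnor 1963, pp. 529–530: every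
`σ(M₀)` lies in `σ₂ℤ = 224ℤ`). Proof: `σ ∈ signatureSet g 2 h (𝕊⁷, o)` provides `c`,
s-parallelizable, and an orientation `μ'` of `M₀ ∪ cone(bM₀)` with `σ(M₀, μ') = σ`; by
`NullCobordism.exists_closed_signatureInDim_eq` (the gluing `X = M₀ ∪_{id} 𝔻⁸` exists, its disc
is a chart ball, collapsing it gives `M₀ ∪ cone(bM₀) ≃ₜ X`, and the signature is a homeomorphism
invariant) `σ = σ(X, μ)` for some orientation `μ` of such an `X`, and `H` applies.
[cite: KervaireMilnorAnnals1963, §7, pp. 529–530 (σₘ; proof of Lemma 7.4) and footnote pp. 528–529] [cite: MilnorKervaireICM1958, Corollary p. 457] [cite: Kosinski1993, IX.8.7 (first half of the proof) and Ch. X §6 p. 217] -/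
theorem twoHundredTwentyFour_dvd_of_mem_signatureSet_sphere_of_closed
    (H : ∀ (c : NullCobordism 7 (Metric.sphere (0 : EuclideanSpace ℝ (Fin (7 + 1))) 1))
        (X : Type) [TopologicalSpace X] [T2Space X] [SecondCountableTopology X] [CompactSpace X]
        [ChartedSpace (EuclideanSpace ℝ (Fin (7 + 1))) X] [IsManifold (𝓡 (7 + 1)) ∞ X],
      IsBoundaryGluing c.boundaryData (closedBallBoundaryData 7) id (𝓡 (7 + 1)) X →
      IsStablyParallelizable (𝓡∂ (7 + 1)) c.W →
      ∀ μ : HomologicalOrientation ℤ X (7 + 1),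
        (224 : ℤ) ∣ μ.signatureInDim (show 2 * 2 + 2 * 2 = 7 + 1 by norm_num)) :
    twoHundredTwentyFour_dvd_of_mem_signatureSet_sphere := by
  intro g h o σ hσ
  obtain ⟨μ, c, μ', -, hspar, -, rfl⟩ := hσ
  obtain ⟨X, _, _, _, _, _, _, hX, μX, hμX⟩ :=
    c.exists_closed_signatureInDim_eq (show 2 * 2 + 2 * 2 = 7 + 1 by norm_num) μ'
  rw [← hμX]
  exact H c X hX hspar μX

end HomotopySphere

end Literature.Topology.FourManifolds
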